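/-
Copyright: the b2b-balaban cell (near-miss cell 7), T⁴-continuum fan-out; row NE7b ROUND-2 swarm, seat
t4-ne7b-formalise-leaf-04 (gen 2) — row S4c (iii) ∕ S7 of `t4/b2b-balaban-t4-ne7b-p1/LEAVES-NE7b.md` (the consumers'
switch of R-OWNER-22-6 (iii), promoted onto the critical path by the typer's `t4/formal/NE7b/DAG.md` §5 v2.3 (b)).
Released under the licence of the surrounding project.
-/
import Summits.QuantumFields.BalabanUV.T4Continuum.Support.HistorySocketTH
import Summits.QuantumFields.BalabanUV.T4Continuum.Support.HistoryExitLE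
import Summits.QuantumFields.BalabanUV.T4Continuum.Support.HistoryCanonLE

/-!
# The history socket on the tree count WITHOUT the renewal-at-reach clause (socket v3, LE sibling)

Summits-side support leaf of the T⁴-continuum cell (rung (B)+1 on a FINITE torus only; NOT infinite volume, NOT the
mass gap, NOT the Clay statement; NOT a proof of the spine estimate NE7b).  Row NE7b, route «COUNT», ROUND-2 swarm
claim table `t4/b2b-balaban-t4-ne7b-p1/LEAVES-NE7b.md`, row S4c (iii) «socket v3 switch» ∕ row S7 (socket family),
seat `t4-ne7b-formalise-leaf-04` gen 2 (the named holder, leaf-10, went offline before filing it; journal l.7223 ∕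
l.7297).  [folklore] bookkeeping over the lineage's OWN typed carrier; nothing is quoted from print, nothing printed is
asserted, no `[cite:]` tag, no `Prop`-valued fact is minted (trigger c1); constants symbolic (c2∕c6).

WHY.  The socket of record `HistorySocketTH.LiveHistoriesTH` (leaf-10, p208411) asks of every live member
`ConsistentTH sh C K (R K) D G′`, whose renewal clause dates a renewal AT the booked reach (`h + 1 = reach`); on
Bałaban's histories that equality is the display `RenewAtReach` (finding F-1(c): it is NOT a fact of the geometry — a
component may be renewed as soon as it is ready).  Row S4c (leaf-02) re-derived the whole exit over
`HistoryBankingLE.ConsistentTLE` (renewal at `h + 1 ≤ reach`): `HistoryExitLE.relWeightBound_canon_of_irThresholdLE`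
(p208972), with `HistoryTreeShapeLE` (p208740) and `HistoryCanonLE` (p208809); row S1b (leaf-08) proved the member
field in that currency straight from the geometric realisation (`HistoryRealiseTimed.consistentTLE_genT_of_realises`,
p209488).  What was missing is the CONSUMERS' half: a socket whose `consistent` field is `ConsistentTLE`, with ENDs over
the LE exit.  This file is that socket; with it the assembly's LE twin is a one-name switch and the display
`RenewAtReach` drops from the END (owner's R-A).

WHAT.  §1 generic LE helpers: `step_le_of_consistentTLE` (events at steps `≤ K`), **`chrono_of_mem_canonFam`** (a tagged
genealogy born by the cutoff whose shape tree is a record of the canonical run IS chronological —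
`T4CanonicalMenus.chrono_of_mem_fam` read back along the step-preserving relabelling `shape ∘ sh`; no consistency
needed), **`wfLE_of_canon`** (`ConsistentTLE ∧ FreshT ∧ canonical shape ⇒ Gen.WF`, by leaf-02's
`HistoryTreeShapeLE.wf_of_consistentTLE_freshT_chrono`).  §2 **`structure
LiveHistoriesTHLE`** = `LiveHistoriesTH` at horizon `D = 0` with the ONE field `consistent` over `ConsistentTLE sh C K
(R K) q.2`; the other nine fields TOKEN FOR TOKEN (`fresh`, `pending : K < reach`, `cell_mem`, `canon`, `old`,
`slot_inj`, `str_inj`, `price`∕`price′` in the SAME currency `HistorySocketTH.shapeTH sh C Λ′ Δ R g 0 K q.2` — so row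
S9b's `Dominates.price_of_pshapeTH`, row S10b's price transport and the assembly's `priceT` readings serve it
unchanged); **`LiveHistoriesTHLE.of_TH`**: every v3 instance at `D = 0` IS an LE instance (`consistentTH_zero_iff`,
`ConsistentTLE.of_consistentT`) — backward compatibility.  §3 the LE exit's (ID) binders DERIVED from the socket:
`chrono_of_live`, `wf_of_live` (no new field: `canon` + `consistent` + `fresh`), **`hlabTLE_of_live`** (at every
branching slot the max-price `yTH … 0 …` is `≤ 0` or the shape of a live arg-max occupant — `ConsistentTLE`, WELL
FORMED, pending, of that shape tree), `hinj_of_live`, **`hstr_of_live`** (`HistoryCanonLE.consistentTLE_rootStep_le`),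
`hF_of_live`∕`hF'_of_live` (leaf-10's `prod_shapeTH_le_famWeight`).  §4 ENDs **`relWeightBound_of_liveHistoriesTHLE`** =
`HistoryExitLE.relWeightBound_canon_of_irThresholdLE` BY NAME with its (ID) binders (`y`∕`hy0`∕`hlabTLE`,
`str`∕`hinj`∕`hstr`, `hF`∕`hF′`) REPLACED by ONE `LiveHistoriesTHLE`; the infrared binder is leaf-02's SHAPE-FREE
`hir : irThresholdTLE C L rr β₀ ≤ log (g K K)⁻²` (constants only, no `sh`, no horizon — the quantifier order of
R-OWNER-22-11 honoured in the same touch); budget `Cn·recordsBudget (Δ·birthMass C) C.κ₁ V Λ η̄₊ j⋆` (the TH budget at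
`D = 0`); **`hybridNE7_of_liveHistoriesTHLE`** (`CountSeamJunction.hybridNE7_of_eventually`).  §5 sanity: empty bad
classes inhabit the socket; the early renewal of `HistoryBankingLE` §4 (renewed at step 3 < reach) is an LE member
shape REJECTED by `ConsistentT` — the LE socket is strictly weaker.  The `_tuned` twins along Bałaban's tuned runs
(flow side from S8 `HistoryFlow`) are the companion leaf `Support/HistorySocketTHLETuned`.

NOT DONE HERE (their holders): the assembly's LE twin (leaf-03, S12: `TermReading` with `consistent` over
`ConsistentTLE` → `hlabTLE` needs `Gen.WF`, supplied by `wfLE_of_canon` ∕ leaf-02's lemma from the `chrono` field;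
`HistorySocketTHLETuned.credits_clampLE` for the clamped run), the LE instance from `Realises` (A12-I.2), the zone
sockets.  HONEST: NE7b NOT
proved; spine 0∕9.  HONEST DEPENDENCY (cell): continuum YM on T⁴ ⇐ BetaPertH ∧ nine spine estimates (0/9 proved);
BetaPertH ⇐ (D1) ∧ (D4) ∧ CAP+tail.  This file changes none of it.
-/

open Finset
open Literature.MathematicalPhysics.QuantumFieldTheory.Balaban1983to89
open T4PersistenceDictionary T4PersistentHistoryCount T4BankedInduction T4PrintedShapeBanking T4WeightBudget
open T4GlobalDenominator T4LiveClassFibration T4LiveStructureGas T4LiveGasToTerms T4RecordPriceSeam T4IndicatorShell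
open T4MatchingAssembly T4MatchingClosure T4MatchingClosureSocket T4PartnerMultiplicity T4Continuum
open T4BranchingRecordsGas T4TaggedShapeBanking T4CanonicalMenus T4CountHorizon
open Summit.QuantumFields.BalabanUV.T4Continuum.CountThresholdUniform
open Summit.QuantumFields.BalabanUV.T4Continuum.CountThresholdExit
open Summit.QuantumFields.BalabanUV.T4Continuum.CountSeamJunction
open Summit.QuantumFields.BalabanUV.T4Continuum.LateMergers
open Summit.QuantumFields.BalabanUV.T4Continuum.HistoryFlow
open Summit.QuantumFields.BalabanUV.T4Continuum.HistorySocketTH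
open Summit.QuantumFields.BalabanUV.T4Continuum.HistoryBankingLE
open Summit.QuantumFields.BalabanUV.T4Continuum.HistoryTreeShapeLE
open Summit.QuantumFields.BalabanUV.T4Continuum.HistoryCanonLE
open Summit.QuantumFields.BalabanUV.T4Continuum.HistoryExitLE

namespace Summit.QuantumFields.BalabanUV.T4Continuum.HistorySocketTHLE

noncomputable section

/-! ## §1 Generic LE helpers: chronology and well-formedness from the canonical shape -/

section Helpers

variable {ε : Type*} [DecidableEq ε] {sh : ε → PEv} {C : T4PrintedShapeBanking.Consts} {K : ℕ} {R : ℕ → ℕ}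

/-- every event of a `ConsistentTLE` genealogy happens at a step `≤ K` (`HistoryCanonLE.consistentTLE_maxStep_le`).
[folklore] -/
theorem step_le_of_consistentTLE {G : Gen ε} (hc : ConsistentTLE sh C K R G) : ∀ e ∈ G.events, (sh e).step ≤ K :=
  fun e he => (step_le_maxStep (PEv.step ∘ sh) G e he).trans (consistentTLE_maxStep_le hc)

omit [DecidableEq ε] in
/-- **A TAGGED GENEALOGY BORN BY THE CUTOFF WHOSE SHAPE TREE IS A RECORD OF THE CANONICAL RUN IS CHRONOLOGICAL**: every
branching record is chronological (`T4CanonicalMenus.chrono_of_mem_fam`, step-faithful menus), and chronology is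
invariant under the step-preserving relabelling `shape ∘ sh` (`chrono_relabel_iff`).  No consistency is used. [folklore] -/
theorem chrono_of_mem_canonFam {Dcap Ncap : ℕ → ℕ} {G : Gen ε} (hj : G.rootStep ≤ K)
    (h : relabel (shape ∘ sh) G ∈ canonFam Dcap Ncap K G.rootStep) : Chrono (PEv.step ∘ sh) G := by
  have h' := (chrono_of_mem_fam (Lren := menuRen) (Lmer := menuMer) (Lpart := dictB Dcap K) (st := PEv.step)
    menuRen_step menuMer_step (dictB_step Dcap K) (Ncap K) (dictB Dcap K G.rootStep) G.rootStep K
    (dictB_step Dcap K G.rootStep) hj _ h).1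
  exact (chrono_relabel_iff (shape ∘ sh) (st := PEv.step ∘ sh) (st' := PEv.step) (fun _ => rfl) G).1 h'

/-- **`ConsistentTLE` ∧ `FreshT` ∧ CANONICAL SHAPE ⇒ WELL FORMED** (`Gen.WF` over the booked window table): chronology
from the canonical shape (`chrono_of_mem_canonFam`), then leaf-02's `HistoryTreeShapeLE.wf_of_consistentTLE_freshT_chrono`.
[folklore] -/
theorem wfLE_of_canon {Dcap Ncap : ℕ → ℕ} {G : Gen ε} (hc : ConsistentTLE sh C K R G) (hf : FreshT G)
    (h : relabel (shape ∘ sh) G ∈ canonFam Dcap Ncap K G.rootStep) : G.WF (dictWT sh R C.n₁) :=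
  wf_of_consistentTLE_freshT_chrono hc hf (chrono_of_mem_canonFam (consistentTLE_rootStep_le hc) h)

end Helpers

/-! ## §2 The LE socket -/

section Defs

variable {ε γ κ : Type*} [DecidableEq ε] [DecidableEq γ]

/-- **THE HISTORY SOCKET ON THE TREE COUNT, NO RENEWAL-AT-REACH CLAUSE** (`LiveHistoriesTH` at horizon `D = 0` with the
member field `consistent` over `ConsistentTLE`).  Data: per cutoff `K` and class `c` the finite set `live K c` of LIVE
MEMBERS `(root cell, tagged genealogy)`.  Obligations for `K ≥ K₀`: per member — `ConsistentTLE` (renewal at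
`h + 1 ≤ reach`), fresh tags, pending at `K`, root cell of the root's age, shape tree in the canonical run family (caps
+ chronology); per class — an OLD member, slot-injectivity WITHIN the class, the class price (both runs) dominated by
the product of the members' shapes `shapeTH … 0 K`; across classes — separation by branching slot families. [folklore] -/
structure LiveHistoriesTHLE (sh : ε → PEv) (C : T4PrintedShapeBanking.Consts) (Λ' Δ : ℝ) (l₀ : ℝ) (K₀ : ℕ)
    (R : ℕ → ℕ → ℕ) (g : ℕ → ℕ → ℝ) (Cell : ℕ → ℕ → Finset γ) (Dcap Ncap : ℕ → ℕ) (jstar : ℕ → ℕ)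
    (Bad' : ℕ → ℝ → Finset κ) (F Rf F' Rf' : ℕ → κ → ℝ) (live : ℕ → κ → Finset (γ × Gen ε)) : Prop where
  /-- (H2b, LE) live members are `ConsistentTLE` at their cutoff (renewal at `h + 1 ≤ reach`) -/
  consistent : ∀ K q, K₀ ≤ K → InLiveTH l₀ Bad' live K q → ConsistentTLE sh C K (R K) q.2
  /-- (H2b) … their tags are fresh -/
  fresh : ∀ K q, K₀ ≤ K → InLiveTH l₀ Bad' live K q → FreshT q.2
  /-- (H2b) … and they are pending at `K` -/
  pending : ∀ K q, K₀ ≤ K → InLiveTH l₀ Bad' live K q → K < q.2.reach (dictWT sh (R K) C.n₁)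
  /-- (H2e) the root cell is a cell of the root's age -/
  cell_mem : ∀ K q, K₀ ≤ K → InLiveTH l₀ Bad' live K q → q.1 ∈ Cell K (K - q.2.rootStep)
  /-- (H2e) the shape tree is a record of the canonical run of its slot (caps and chronology) -/
  canon : ∀ K q, K₀ ≤ K → InLiveTH l₀ Bad' live K q → relabel (shape ∘ sh) q.2 ∈ canonFam Dcap Ncap K q.2.rootStep
  /-- (H2e) every bad class has an OLD live member (born before the matching scale) -/
  old : ∀ K t, |t| ≤ l₀ → K₀ ≤ K → ∀ c ∈ Bad' K t, ∃ q ∈ live K c, q.2.rootStep < jstar K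
  /-- (H2e) WITHIN a class, distinct live members occupy distinct branching slots -/
  slot_inj : ∀ K t, |t| ≤ l₀ → K₀ ≤ K → ∀ c ∈ Bad' K t, Set.InjOn (bslotOf sh) (live K c : Set (γ × Gen ε))
  /-- (H2e) distinct bad classes have distinct branching slot families -/
  str_inj : ∀ K t, |t| ≤ l₀ → K₀ ≤ K → Set.InjOn (bstrOf sh live K) (Bad' K t)
  /-- (P) run A: the class price is dominated by the product of the members' price shapes (horizon `0`) -/
  price : ∀ K t, |t| ≤ l₀ → K₀ ≤ K → ∀ c ∈ Bad' K t,
    F K c * Rf K c ≤ ∏ q ∈ live K c, shapeTH sh C Λ' Δ R g 0 K q.2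
  /-- (P) run A′: the same -/
  price' : ∀ K t, |t| ≤ l₀ → K₀ ≤ K → ∀ c ∈ Bad' K t,
    F' K c * Rf' K c ≤ ∏ q ∈ live K c, shapeTH sh C Λ' Δ R g 0 K q.2

variable {sh : ε → PEv} {C : T4PrintedShapeBanking.Consts} {Λ' Δ l₀ : ℝ} {K₀ : ℕ} {R : ℕ → ℕ → ℕ} {g : ℕ → ℕ → ℝ}
  {Cell : ℕ → ℕ → Finset γ} {Dcap Ncap : ℕ → ℕ} {jstar : ℕ → ℕ} {Bad' : ℕ → ℝ → Finset κ}
  {F Rf F' Rf' : ℕ → κ → ℝ} {live : ℕ → κ → Finset (γ × Gen ε)}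

/-- **BACKWARD COMPATIBILITY: every v3 instance at horizon `0` IS an LE instance** (`ConsistentTH … 0 ↔ ConsistentT`,
`ConsistentTLE.of_consistentT`; `K − 0 < reach` is `K < reach`; every other field verbatim). [folklore] -/
theorem LiveHistoriesTHLE.of_TH (H : LiveHistoriesTH sh C Λ' Δ l₀ K₀ R g Cell Dcap Ncap jstar 0 Bad' F Rf F' Rf' live) :
    LiveHistoriesTHLE sh C Λ' Δ l₀ K₀ R g Cell Dcap Ncap jstar Bad' F Rf F' Rf' live where
  consistent K q hK hq := ConsistentTLE.of_consistentT (consistentTH_zero_iff.1 (H.consistent K q hK hq))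
  fresh := H.fresh
  pending K q hK hq := by simpa using H.pending K q hK hq
  cell_mem := H.cell_mem
  canon := H.canon
  old := H.old
  slot_inj := H.slot_inj
  str_inj := H.str_inj
  price := H.price
  price' := H.price'

end Defs

/-! ## §3 The (ID) binders of the LE exit, DERIVED from the socket -/

section Derived

variable {ε γ κ : Type*} [DecidableEq ε] {sh : ε → PEv} {C : T4PrintedShapeBanking.Consts} {Λ' Δ l₀ : ℝ} {K₀ : ℕ}
  {R : ℕ → ℕ → ℕ} {g : ℕ → ℕ → ℝ} {Cell : ℕ → ℕ → Finset γ} {Dcap Ncap : ℕ → ℕ} {jstar : ℕ → ℕ}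
  {Bad' : ℕ → ℝ → Finset κ} {F Rf F' Rf' : ℕ → κ → ℝ} {live : ℕ → κ → Finset (γ × Gen ε)}

variable [DecidableEq γ]

/-- live members are chronological (from `canon` and `consistent`, by `chrono_of_mem_canonFam`). [folklore] -/
theorem chrono_of_live (H : LiveHistoriesTHLE sh C Λ' Δ l₀ K₀ R g Cell Dcap Ncap jstar Bad' F Rf F' Rf' live)
    {K : ℕ} {q : γ × Gen ε} (hK : K₀ ≤ K) (hq : InLiveTH l₀ Bad' live K q) : Chrono (PEv.step ∘ sh) q.2 :=
  chrono_of_mem_canonFam (consistentTLE_rootStep_le (H.consistent K q hK hq)) (H.canon K q hK hq)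

/-- live members are well formed over the booked window table (from `consistent`, `fresh`, `canon`; no timing display).
[folklore] -/
theorem wf_of_live (H : LiveHistoriesTHLE sh C Λ' Δ l₀ K₀ R g Cell Dcap Ncap jstar Bad' F Rf F' Rf' live)
    {K : ℕ} {q : γ × Gen ε} (hK : K₀ ≤ K) (hq : InLiveTH l₀ Bad' live K q) : q.2.WF (dictWT sh (R K) C.n₁) :=
  wfLE_of_canon (H.consistent K q hK hq) (H.fresh K q hK hq) (H.canon K q hK hq)

/-- **`hlabTLE` FROM THE SOCKET**: at every branching slot the max-price (horizon `0`) is `≤ 0` or the shape of a live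
member — `ConsistentTLE`, WELL FORMED, pending, of that shape tree — an arg-max occupant; the price clause in the LE
exit's form (true window table, `padW W 0 = W`). [folklore] -/
theorem hlabTLE_of_live
    (H : LiveHistoriesTHLE sh C Λ' Δ l₀ K₀ R g Cell Dcap Ncap jstar Bad' F Rf F' Rf' live)
    (hfin : ∀ K, K₀ ≤ K → BadFin l₀ Bad' K)
    (K : ℕ) (hK : K₀ ≤ K) (j : ℕ) (_hj : j ≤ K) (z : γ) (_hz : z ∈ Cell K (K - j)) (G : Gen PEv)
    (_hG : G ∈ canonFam Dcap Ncap K j) :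
    yTH sh C Λ' Δ l₀ R g 0 Bad' live K j z G ≤ 0 ∨
      ∃ G' : Gen ε, ConsistentTLE sh C K (R K) G' ∧ G'.WF (dictWT sh (R K) C.n₁) ∧
        K < G'.reach (dictWT sh (R K) C.n₁) ∧ relabel (shape ∘ sh) G' = G ∧
        yTH sh C Λ' Δ l₀ R g 0 Bad' live K j z G ≤
          Δ * (Λ' ^ partnerAges (PEv.step ∘ sh) G' * (Real.exp (-credits (credit C (g K) ∘ sh) G') *
            Real.exp (lifeCost (dictWT sh (R K) C.n₁) (costT sh C K (R K)) G'))) := by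
  have hne : (insert (0 : ℝ) (occShapes sh C Λ' Δ l₀ R g 0 Bad' live K ⟨j, z, G⟩)).Nonempty :=
    ⟨0, Set.mem_insert _ _⟩
  have hmem := hne.csSup_mem ((occShapes_finite (hfin K hK) _).insert 0)
  rcases Set.mem_insert_iff.1 hmem with h0 | hS
  · left
    unfold yTH
    exact le_of_eq h0
  · right
    obtain ⟨q, hin, hslot, hx⟩ := hS
    simp only [bslotOf, Sigma.mk.inj_iff, heq_eq_eq] at hslot
    obtain ⟨rfl, rfl, rfl⟩ := hslot
    refine ⟨q.2, H.consistent K q hK hin, wf_of_live H hK hin, H.pending K q hK hin, rfl, ?_⟩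
    unfold yTH
    rw [hx, shapeTH, padW_zero]

/-- **`hinj` FROM THE SOCKET** (the field `str_inj`). [folklore] -/
theorem hinj_of_live (H : LiveHistoriesTHLE sh C Λ' Δ l₀ K₀ R g Cell Dcap Ncap jstar Bad' F Rf F' Rf' live)
    (K : ℕ) (t : ℝ) (ht : |t| ≤ l₀) (hK : K₀ ≤ K) : Set.InjOn (bstrOf sh live K) (Bad' K t) :=
  H.str_inj K t ht hK

/-- **`hstr` FROM THE SOCKET**: the branching slot family of a bad class consists of LIVE branching slots (born by the
cutoff: `consistentTLE_rootStep_le`) and contains an OLD one. [folklore] -/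
theorem hstr_of_live (H : LiveHistoriesTHLE sh C Λ' Δ l₀ K₀ R g Cell Dcap Ncap jstar Bad' F Rf F' Rf' live)
    (K : ℕ) (t : ℝ) (ht : |t| ≤ l₀) (hK : K₀ ≤ K) :
    ∀ c ∈ Bad' K t, bstrOf sh live K c ⊆ bliveSlots Cell (canonFam Dcap Ncap) K ∧
      ∃ o ∈ boldSlots Cell (canonFam Dcap Ncap) jstar K, o ∈ bstrOf sh live K c := by
  intro c hc
  refine ⟨fun s hs => ?_, ?_⟩
  · obtain ⟨q, hq, rfl⟩ := mem_image.1 hs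
    have hin : InLiveTH l₀ Bad' live K q := ⟨t, ht, c, hc, hq⟩
    simp only [bliveSlots, bslotOf, mem_sigma, mem_range]
    exact ⟨Nat.lt_succ_of_le (consistentTLE_rootStep_le (H.consistent K q hK hin)), H.cell_mem K q hK hin,
      H.canon K q hK hin⟩
  · obtain ⟨q, hq, hold⟩ := H.old K t ht hK c hc
    have hin : InLiveTH l₀ Bad' live K q := ⟨t, ht, c, hc, hq⟩
    refine ⟨bslotOf sh q, ?_, mem_image_of_mem _ hq⟩
    simp only [boldSlots, bslotOf, mem_sigma, mem_range]
    exact ⟨hold, H.cell_mem K q hK hin, H.canon K q hK hin⟩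

/-- **`hF` FROM THE SOCKET**: the class price is dominated by the family weight of its branching slot family at the
max-price (`price`, then leaf-10's `prod_shapeTH_le_famWeight` on the class). [folklore] -/
theorem hF_of_live (hΔ : 0 ≤ Δ) (hΛ : 0 ≤ Λ')
    (H : LiveHistoriesTHLE sh C Λ' Δ l₀ K₀ R g Cell Dcap Ncap jstar Bad' F Rf F' Rf' live)
    {K : ℕ} (hfin : BadFin l₀ Bad' K) (t : ℝ) (ht : |t| ≤ l₀) (hK : K₀ ≤ K) :
    ∀ c ∈ Bad' K t,
      F K c * Rf K c ≤ famWeight (bslotPrice (yTH sh C Λ' Δ l₀ R g 0 Bad' live K)) (bstrOf sh live K c) :=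
  fun c hc => (H.price K t ht hK c hc).trans
    (prod_shapeTH_le_famWeight hΔ hΛ hfin (fun _ hq => ⟨t, ht, c, hc, hq⟩) (H.slot_inj K t ht hK c hc))

/-- … and `hF′`. [folklore] -/
theorem hF'_of_live (hΔ : 0 ≤ Δ) (hΛ : 0 ≤ Λ')
    (H : LiveHistoriesTHLE sh C Λ' Δ l₀ K₀ R g Cell Dcap Ncap jstar Bad' F Rf F' Rf' live)
    {K : ℕ} (hfin : BadFin l₀ Bad' K) (t : ℝ) (ht : |t| ≤ l₀) (hK : K₀ ≤ K) :
    ∀ c ∈ Bad' K t,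
      F' K c * Rf' K c ≤ famWeight (bslotPrice (yTH sh C Λ' Δ l₀ R g 0 Bad' live K)) (bstrOf sh live K c) :=
  fun c hc => (H.price' K t ht hK c hc).trans
    (prod_shapeTH_le_famWeight hΔ hΛ hfin (fun _ hq => ⟨t, ht, c, hc, hq⟩) (H.slot_inj K t ht hK c hc))

end Derived

/-! ## §4 The LE exit and the seam over the socket -/

section Exit

variable {ε γ κ ι : Type*} [DecidableEq ε] [DecidableEq γ] [DecidableEq κ] [DecidableEq ι] {l₀ vol : ℝ} {K₀ : ℕ}
  {π : ℕ → ι → κ} {T : ℕ → Finset ι} {A A' shA shB : ℕ → ℝ → ι → ℝ} {Bad' : ℕ → ℝ → Finset κ}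
  {dead dead' : ℕ → ℝ → ι → ℝ} {F Rf F' Rf' : ℕ → κ → ℝ} {nlow nup mlow mup : ℕ → ℝ → ℝ} {Cn : ℝ}
  {Cc Rr CcRec RrRec : ℕ → ℝ → ι → ℝ} {ν u s₂ c₀ r s Wsh : ℕ → ℝ}

omit [DecidableEq ι] in
/-- **NE7b's TREE-COUNT EXIT OVER THE LE SOCKET.**  Leaf-02's `HistoryExitLE.relWeightBound_canon_of_irThresholdLE`
(the TH exit at `D = 0` without the renewal-at-reach clause) with its (ID) binders (`y`∕`hy0`∕`hlabTLE`,
`str`∕`hinj`∕`hstr`, `hF`, `hF′`) REPLACED by ONE `LiveHistoriesTHLE` hypothesis (the finiteness behind the max-price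
comes from `hA.bad_subset`); infrared binder at the SHAPE-FREE threshold `irThresholdTLE C L rr β₀`; every other binder
verbatim; conclusion = the exit's. [folklore] -/
theorem relWeightBound_of_liveHistoriesTHLE (sh : ε → PEv) {C : T4PrintedShapeBanking.Consts} {L rr : ℕ} {β₀ : ℝ}
    (h : ThresholdOK C L rr β₀) (hμ₀ : 0 < C.μ)
    (Cell : ℕ → ℕ → Finset γ) {V Λ : ℝ} (hV : 0 ≤ V) (hΛ : 0 < Λ)
    (hcell : ∀ K a, ((Cell K a).card : ℝ) ≤ V * Λ ^ a) (Dcap Ncap : ℕ → ℕ)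
    (jstar : ℕ → ℕ) (hj : ∀ K, jstar K ≤ K) {c : ℝ} (hc : 0 < c)
    (hfrac : ∀ K : ℕ, c * K ≤ ((K - jstar K : ℕ) : ℝ)) {Δ : ℝ} (hΔ : 1 ≤ Δ)
    (hA : Regeneration l₀ π T A Bad' dead F Rf nlow nup Cn K₀)
    (hA' : Regeneration l₀ π T A' Bad' dead' F' Rf' mlow mup Cn K₀) (hCn : 0 ≤ Cn)
    (R : ℕ → ℕ → ℕ) (g : ℕ → ℕ → ℝ) (β' : ℕ → ℝ)
    (h27 : ∀ K, K₀ ≤ K → B14.FlowIneq27 (g K) (β' K) β₀ C.p₀ K)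
    (h29 : ∀ K, K₀ ≤ K → B14FlowStep.FlowIneq29 (R K) (g K) L (β' K) β₀ K)
    (hR : ∀ K, K₀ ≤ K → ∀ s, s ≤ K → B14.IsRj L rr (g K s) (R K s))
    (hx1 : ∀ K, K₀ ≤ K → ∀ s, s ≤ K → 1 ≤ Real.log ((g K s) ^ 2)⁻¹)
    (hir : ∀ K, K₀ ≤ K → irThresholdTLE C L rr β₀ ≤ Real.log ((g K K) ^ 2)⁻¹)
    (hP : ∀ K s, 0 ≤ p0Profile C.A₀ C.p₀ (g K s))
    {ηplus : ℝ} (hηplus : 0 ≤ ηplus) (hr : Λ * Real.exp (ηplus - C.κ₁) < 1)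
    {Λ' : ℝ} (hΛ0 : 0 ≤ Λ') (h1 : Λ' * Real.exp (-C.κ₁) * Real.exp ηplus < 1)
    (hx : (Real.exp (-C.E₀) + Real.exp (-C.E₀) * birthMass C *
          (Λ' * Real.exp (-C.κ₁) / (1 - Λ' * Real.exp (-C.κ₁) * Real.exp ηplus))) * Real.exp ηplus ≤
        Real.exp ηplus - 1)
    {live : ℕ → κ → Finset (γ × Gen ε)}
    (H : LiveHistoriesTHLE sh C Λ' Δ l₀ K₀ R g Cell Dcap Ncap jstar Bad' F Rf F' Rf' live) :
    ∃ K₁, K₀ ≤ K₁ ∧ RelWeightBound l₀ T A A' (fun K t => if K₁ ≤ K then badOfClass π T Bad' K t else ∅)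
      (Set.indicator {K | K₁ ≤ K}
        (fun K => Cn * recordsBudget (Δ * birthMass C) C.κ₁ V Λ ηplus jstar K)) :=
  have hΔ0 : (0 : ℝ) ≤ Δ := zero_le_one.trans hΔ
  relWeightBound_canon_of_irThresholdLE sh h hμ₀ Cell hV hΛ hcell Dcap Ncap jstar hj hc hfrac hΔ hA hA' hCn R g β' h27
    h29 hR hx1 hir hP hηplus hr hΛ0 h1 hx (yTH sh C Λ' Δ l₀ R g 0 Bad' live)
    (fun K j _ z _ G _ => yTH_nonneg K j z G) (hlabTLE_of_live H fun _ hK => badFin_of_regeneration hA hK)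
    (bstrOf sh live) (hinj_of_live H) (hstr_of_live H)
    (fun _ t ht hK => hF_of_live hΔ0 hΛ0 H (badFin_of_regeneration hA hK) t ht hK)
    (fun _ t ht hK => hF'_of_live hΔ0 hΛ0 H (badFin_of_regeneration hA hK) t ht hK)

/-- **… AND INTO THE SEAM** (`CountSeamJunction.hybridNE7_of_eventually`): + NE7c's `ShellWeightBound`, NE7's
`ReindexedBudget`, four summable rates ⇒ `HybridNE7` for the shifted families. [folklore] -/
theorem hybridNE7_of_liveHistoriesTHLE (sh : ε → PEv) {C : T4PrintedShapeBanking.Consts} {L rr : ℕ} {β₀ : ℝ}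
    (h : ThresholdOK C L rr β₀) (hμ₀ : 0 < C.μ)
    (Cell : ℕ → ℕ → Finset γ) {V Λ : ℝ} (hV : 0 ≤ V) (hΛ : 0 < Λ)
    (hcell : ∀ K a, ((Cell K a).card : ℝ) ≤ V * Λ ^ a) (Dcap Ncap : ℕ → ℕ)
    (jstar : ℕ → ℕ) (hj : ∀ K, jstar K ≤ K) {c : ℝ} (hc : 0 < c)
    (hfrac : ∀ K : ℕ, c * K ≤ ((K - jstar K : ℕ) : ℝ)) {Δ : ℝ} (hΔ : 1 ≤ Δ)
    (hA : Regeneration l₀ π T A Bad' dead F Rf nlow nup Cn K₀)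
    (hA' : Regeneration l₀ π T A' Bad' dead' F' Rf' mlow mup Cn K₀) (hCn : 0 ≤ Cn)
    (R : ℕ → ℕ → ℕ) (g : ℕ → ℕ → ℝ) (β' : ℕ → ℝ)
    (h27 : ∀ K, K₀ ≤ K → B14.FlowIneq27 (g K) (β' K) β₀ C.p₀ K)
    (h29 : ∀ K, K₀ ≤ K → B14FlowStep.FlowIneq29 (R K) (g K) L (β' K) β₀ K)
    (hR : ∀ K, K₀ ≤ K → ∀ s, s ≤ K → B14.IsRj L rr (g K s) (R K s))
    (hx1 : ∀ K, K₀ ≤ K → ∀ s, s ≤ K → 1 ≤ Real.log ((g K s) ^ 2)⁻¹)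
    (hir : ∀ K, K₀ ≤ K → irThresholdTLE C L rr β₀ ≤ Real.log ((g K K) ^ 2)⁻¹)
    (hP : ∀ K s, 0 ≤ p0Profile C.A₀ C.p₀ (g K s))
    {ηplus : ℝ} (hηplus : 0 ≤ ηplus) (hr : Λ * Real.exp (ηplus - C.κ₁) < 1)
    {Λ' : ℝ} (hΛ0 : 0 ≤ Λ') (h1 : Λ' * Real.exp (-C.κ₁) * Real.exp ηplus < 1)
    (hx : (Real.exp (-C.E₀) + Real.exp (-C.E₀) * birthMass C *
          (Λ' * Real.exp (-C.κ₁) / (1 - Λ' * Real.exp (-C.κ₁) * Real.exp ηplus))) * Real.exp ηplus ≤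
        Real.exp ηplus - 1)
    {live : ℕ → κ → Finset (γ × Gen ε)}
    (H : LiveHistoriesTHLE sh C Λ' Δ l₀ K₀ R g Cell Dcap Ncap jstar Bad' F Rf F' Rf' live)
    (hSh : ShellWeightBound l₀ T A A' shA shB Wsh)
    (hTB : ReindexedBudget l₀ vol T (fun K t τ => A K t τ - shA K t τ) (fun K t τ => A' K t τ - shB K t τ)
      (badOfClass π T Bad') Cc Rr CcRec RrRec ν u s₂ c₀ r s)
    (hrs : Summable r) (hu : Summable u) (hs : Summable s) (hs₂ : Summable s₂) :
    ∃ K₁ K₂, K₀ ≤ K₁ ∧ HybridNE7 l₀ vol (fun K => T (K₁ + (K₂ + K))) (fun K => A (K₁ + (K₂ + K)))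
      (fun K => A' (K₁ + (K₂ + K))) (fun K => badOfClass π T Bad' (K₁ + (K₂ + K)))
      (fun K => Cn * recordsBudget (Δ * birthMass C) C.κ₁ V Λ ηplus jstar (K₁ + (K₂ + K)))
      (fun K => shA (K₁ + (K₂ + K))) (fun K => shB (K₁ + (K₂ + K))) (fun K => Wsh (K₁ + (K₂ + K)))
      (fun K => (r (K₁ + (K₂ + K)) + u (K₁ + (K₂ + K))) + (s (K₁ + (K₂ + K)) + s₂ (K₁ + (K₂ + K)))) :=
  hybridNE7_of_eventually
    (relWeightBound_of_liveHistoriesTHLE sh h hμ₀ Cell hV hΛ hcell Dcap Ncap jstar hj hc hfrac hΔ hA hA' hCn R g β'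
      h27 h29 hR hx1 hir hP hηplus hr hΛ0 h1 hx H)
    hSh hTB hrs hu hs hs₂

end Exit

/-! ## §5 Sanity: the socket with no bad class; an LE member shape that is not a v3 member shape -/

namespace Sanity

/-- With EMPTY bad classes every field of `LiveHistoriesTHLE` holds for the empty live families. [folklore] -/
example (C : T4PrintedShapeBanking.Consts) (Λ' Δ l₀ : ℝ) (K₀ : ℕ) (R : ℕ → ℕ → ℕ) (g : ℕ → ℕ → ℝ)
    (Cell : ℕ → ℕ → Finset ℕ) (Dcap Ncap jstar : ℕ → ℕ) (F Rf F' Rf' : ℕ → ℕ → ℝ) :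
    LiveHistoriesTHLE (Prod.fst : PEv × ℕ → PEv) C Λ' Δ l₀ K₀ R g Cell Dcap Ncap jstar (fun _ _ => (∅ : Finset ℕ))
      F Rf F' Rf' (fun _ _ => (∅ : Finset (ℕ × Gen (PEv × ℕ)))) where
  consistent _ _ _ hq := by obtain ⟨_, _, _, hc, _⟩ := hq; simp at hc
  fresh _ _ _ hq := by obtain ⟨_, _, _, hc, _⟩ := hq; simp at hc
  pending _ _ _ hq := by obtain ⟨_, _, _, hc, _⟩ := hq; simp at hc
  cell_mem _ _ _ hq := by obtain ⟨_, _, _, hc, _⟩ := hq; simp at hc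
  canon _ _ _ hq := by obtain ⟨_, _, _, hc, _⟩ := hq; simp at hc
  old _ _ _ _ _ hc := by simp at hc
  slot_inj _ _ _ _ _ hc := by simp at hc
  str_inj _ _ _ _ := by simp [Set.InjOn]
  price _ _ _ _ _ hc := by simp at hc
  price' _ _ _ _ _ hc := by simp at hc

open HistoryBankingLE.Sanity T4PrintedShapeBanking.XreadC4

/-- The early renewal of `HistoryBankingLE` §4 (renewed at step `3`, reach later) is `ConsistentTLE` at every cutoff
`K ≥ 3` but NOT `ConsistentT` — a member shape the LE socket admits and the v3 socket rejects. [folklore] -/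
example {K : ℕ} (hK : 3 ≤ K) :
    ConsistentTLE (Prod.fst : PEv × ℕ → PEv) C₀ K (fun _ => 2) early ∧
      ¬ ConsistentT (Prod.fst : PEv × ℕ → PEv) C₀ K (fun _ => 2) early :=
  ⟨early_consistentTLE hK, early_not_consistentT K⟩

end Sanity

end

end Summit.QuantumFields.BalabanUV.T4Continuum.HistorySocketTHLE
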